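/-
Copyright: cell pub-balaban-gaps (YM BLITZ Y1, track G1), seat g1-p2 GEN 8 (unit `pub-balaban-gaps-g1-p2`).  Row (D4) NODE O,
OBJECT ∕ MECHANISM level, CARRIER-GENERIC: Cor. 3.5's step for the covariant Laplacian OF A BOND FIELD `U` in the fundamental
representation (defects `W⁺_μ(x) = U_μ(x) − 1`, `W⁻_μ(x) = U_μ(x − e_μ)⁻¹ − 1`), under print's LEVEL-DEPENDENT (3.37) windows read as
weighted letters on the bond field — bond `Σ_b‖(U^±_μ − 1)_{ab}‖ ≤ ηα₀·w(x)`, derivative `Σ_b‖(U_μ(x) − U_μ(x − e_μ))_{ab}‖ ≤ η²α₁·w(x)²` —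
plus the weighted covariant-averaging slot `Ã(u)(w² ⊗ 1)`.  The divergence window `η²|ι|(α₁ + α₀²)w²` comes from the identity
`(U − 1) + (U′⁻¹ − 1) = (U − U′) − (U′ − 1)(U′⁻¹ − 1)`.  HONEST FRAMING: elementary; `U` is a hypothesis SHAPE (not `e^{iηA}` from
(3.35)–(3.36)); (D4) NOT discharged (instance 0∕1); NOT BetaPertH, NOT continuum, NOT Clay.
-/
import Summits.QuantumFields.BalabanUV.Gaps.D4WalkBlockShiftWeightedAv
import Summits.QuantumFields.BalabanUV.Gaps.D4WalkBlockContourWindow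

/-!
# `Gaps.D4WalkBlockBondFieldWeighted` — Cor. 3.5's step for the covariant Laplacian of a bond field (fundamental representation)
# under level-weighted (3.37) windows, with the averaging slot (carrier-generic; cell pub-balaban-gaps, seat g1-p2 gen 8)

HONEST DEPENDENCY (cell pub-balaban, verbatim): continuum YM on T⁴ ⇐ BetaPertH ∧ nine spine estimates (0/9 proved);
BetaPertH ⇐ (D1) ∧ (D4) ∧ CAP+tail.

* §1 **`rowSum_fwd_bwd_defect_le`**: `U′U′⁻¹ = 1`, rows of `U − U′` at most `ε′`, of `U′ − 1` at most `δ`, of `U′⁻¹ − 1` at most `δ′`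
  ⟹ rows of `(U − 1) + (U′⁻¹ − 1)` at most `ε′ + δδ′` (the divergence of the defects is a DERIVATIVE of the bond field plus a quadratic
  term — print's `|∂A| + |A|²`); `bondDefect_holo`;
* §2 **`blockWalkExpansion_bondFieldW_of_letters`** — COR. 3.5's STEP FOR `V_W(U) + Ã(u)(w² ⊗ 1)`: forward bond transporters
  `U_μ(u,x)` with inverses `U_μ(u,x)⁻¹`, holomorphic, with the WEIGHTED bond letters at `x` and at `x − e_μ` (`ηα₀w(x)`) and the
  weighted derivative letter (`η²α₁w(x)²`); `Ã` cube-local with row sums `≤ α_av`; any kernel with value + weighted letters; margin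
  `c_μ(c_μ·1·(1·((0 + Σ_j covAlphaW α₀ (|ι|(α₁ + α₀²) + α_av) j·covBW ρ Λ j)C))c_μ)c_μ < 1` ⟹ block walk expansion with letters `covBW ρ Λ`.
WHAT IT IS NOT.  The instance (it is `D4WalkBlockCovariantBondFieldMultiLevel`); `U = e^{iηA}`; (D4) instance 0∕1; words UNCHANGED.

References: T. Bałaban, Comm. Math. Phys. **99** (1985) 389–434 [B9], (3.37) p. 396, (3.50)–(3.54) pp. 400–401, (3.61) p. 402, Cor. 3.5
p. 407; Comm. Math. Phys. **96** (1984) [4], Prop. 2.2 (2.67) p. 234.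
-/

noncomputable section

namespace Summit.QuantumFields.BalabanUV.Gaps.D4WalkBlockBondFieldWeighted

open Metric
open scoped Matrix
open Literature.MathematicalPhysics.QuantumFieldTheory.Balaban1983to89
open Literature.MathematicalPhysics.QuantumFieldTheory.Balaban1983to89.B9SectDWalk (DomBy)
open Literature.MathematicalPhysics.QuantumFieldTheory.Balaban1983to89.B9Thm34Ext (toB6)
open Literature.MathematicalPhysics.QuantumFieldTheory.Balaban1983to89.B9Thm37GlueTorus (torusGeom tdist1)
open Literature.MathematicalPhysics.QuantumFieldTheory.Balaban1983to89.TreeLengthTorus (TPt)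
open Literature.MathematicalPhysics.QuantumFieldTheory.Balaban1983to89.B5TorusCover (UT)
open Literature.MathematicalPhysics.QuantumFieldTheory.Balaban1983to89.B11SectG (RowSum)
open Summit.QuantumFields.BalabanUV.Gaps.D4WalkBlock (blockNorm BlockWalkExpansion)
open Summit.QuantumFields.BalabanUV.Gaps.D4WalkBlockShiftAlgebra (Dfw covShift)
open Summit.QuantumFields.BalabanUV.Gaps.D4WalkBlockShiftWeighted (wOp covDopW covBW covAlphaW)
open Summit.QuantumFields.BalabanUV.Gaps.D4WalkBlockShiftWeightedAv (blockWalkExpansion_covShiftWAv_of_letters)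
open Summit.QuantumFields.BalabanUV.Gaps.D4WalkBlockShiftTransport (rowMass_sum_le')
open Summit.QuantumFields.BalabanUV.Gaps.D4WalkBlockContourWindow (rowSum_mul_le')

variable {X : Type} {F : Type}
variable {ν : ℕ} {Kv : Fin ν → ℕ}

/-! ## §1. The divergence of the defects of a bond field: derivative plus quadratic term -/

section Fibre
variable [Fintype F] [DecidableEq F]

/-- **`(U − 1) + (U′⁻¹ − 1) = (U − U′) − (U′ − 1)(U′⁻¹ − 1)`, in row sums**: `ε′ + δδ′`.
[cite: Balaban1985BackgroundPropagators, (3.54) p.401, (3.37) p.396] -/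
theorem rowSum_fwd_bwd_defect_le (U U' Ui' : Matrix F F ℂ) (hinv : U' * Ui' = 1) {δ δ' ε' : ℝ} (hδ' : 0 ≤ δ')
    (h1 : ∀ a, ∑ b, ‖(U - U') a b‖ ≤ ε') (h2 : ∀ a, ∑ b, ‖(U' - 1) a b‖ ≤ δ) (h3 : ∀ a, ∑ b, ‖(Ui' - 1) a b‖ ≤ δ') (a : F) :
    ∑ b, ‖((U - 1) + (Ui' - 1)) a b‖ ≤ ε' + δ * δ' := by
  have h4 : (U' - 1) * (Ui' - 1) = 1 - U' - (Ui' - 1) := by rw [sub_mul, one_mul, mul_sub, mul_one, hinv]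
  have e : (U - 1) + (Ui' - 1) = (U - U') - (U' - 1) * (Ui' - 1) := by rw [h4]; abel
  rw [e]
  have hδ : 0 ≤ δ := le_trans (Finset.sum_nonneg fun b _ => norm_nonneg _) (h2 a)
  calc ∑ b, ‖((U - U') - (U' - 1) * (Ui' - 1)) a b‖
      ≤ ∑ b, (‖(U - U') a b‖ + ‖((U' - 1) * (Ui' - 1)) a b‖) :=
        Finset.sum_le_sum fun b _ => by rw [Matrix.sub_apply]; exact norm_sub_le _ _
    _ = ∑ b, ‖(U - U') a b‖ + ∑ b, ‖((U' - 1) * (Ui' - 1)) a b‖ := Finset.sum_add_distrib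
    _ ≤ ε' + (∑ e, ‖(U' - 1) a e‖) * δ' := add_le_add (h1 a) (rowSum_mul_le' _ _ h3 a)
    _ ≤ ε' + δ * δ' := by gcongr; exact h2 a

omit [Fintype F] in
/-- entries of `U(u) − 1` are holomorphic when the entries of `U` are. -/
theorem bondDefect_holo {E : Type*} [NormedAddCommGroup E] [NormedSpace ℂ E] {s : Set E} {U : E → Matrix F F ℂ}
    (hU : ∀ a b, DifferentiableOn ℂ (fun u => U u a b) s) (a b : F) : DifferentiableOn ℂ (fun u => (U u - 1) a b) s := by
  simp only [Matrix.sub_apply]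
  exact (hU a b).sub (differentiableOn_const _)

end Fibre

/-! ## §2. Cor. 3.5's step for the covariant Laplacian of a bond field under level-weighted windows -/

section Step
variable [Fintype X] [Fintype F] [DecidableEq X] [DecidableEq F] {ι : Type} [Fintype ι] {sh : ι → X ≃ X} {η : ℝ} {w : X → ℝ}
variable [∀ i, NeZero (Kv i)]
variable {dd N' : ℕ} {E : Type*} [NormedAddCommGroup E] [NormedSpace ℂ E]

/-- **[B9] COR. 3.5's STEP FOR THE COVARIANT LAPLACIAN OF A BOND FIELD (fundamental representation) UNDER LEVEL-WEIGHTED (3.37) WINDOWS,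
WITH THE AVERAGING SLOT.**  Data as `D4WalkBlockShiftWeightedAv.blockWalkExpansion_covShiftWAv_of_letters`, the defects being
`W⁺_μ(u,x) = U_μ(u,x) − 1`, `W⁻_μ(u,x) = U_μ(u, sh_μ⁻¹x)⁻¹ − 1` for holomorphic forward bond transporters `U_μ(u,x)` with inverses; windows:
rows of `U_μ(u,x) − 1`, `U_μ(u,sh_μ⁻¹x) − 1`, `U_μ(u,sh_μ⁻¹x)⁻¹ − 1` at most `ηα₀w(x)`, rows of `U_μ(u,x) − U_μ(u,sh_μ⁻¹x)` at most `η²α₁w(x)²`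
⟹ bond window `α₀`, divergence window `|ι|(α₁ + α₀²)` (§1), and the expansion with margin
`c_μ(c_μ·1·(1·((0 + Σ_j covAlphaW α₀ (|ι|(α₁ + α₀²) + α_av) j·covBW ρ Λ j)C))c_μ)c_μ < 1`.
[cite: Balaban1985BackgroundPropagators, Cor. 3.5 p.407, (3.37) p.396, (3.50)–(3.54) pp.400–401, (3.61) p.402; Balaban1988RG2Cluster, (1.11) p.5] -/
theorem blockWalkExpansion_bondFieldW_of_letters (cub : X → UT Kv) (hη : 0 < η) (hw : ∀ x, 0 < w x) {Λ : ℝ} (hΛ : 0 ≤ Λ)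
    (hsh : ∀ μ x, tdist1 Kv (cub ((sh μ).symm x)) (cub x) ≤ 1) (hwr : ∀ μ x, w x ≤ Λ * w ((sh μ).symm x))
    (G : Matrix (X × F) (X × F) ℂ) {C ρ : ℝ} (hC : 0 ≤ C) (hρ : 0 ≤ ρ)
    (hG : ∀ Y Y', blockNorm (fun p : X × F => cub p.1) (fun p : X × F => cub p.1) G Y Y' ≤ C * Real.exp (-(ρ * tdist1 Kv Y Y')))
    (hGw2 : ∀ Y Y', blockNorm (fun p : X × F => cub p.1) (fun p : X × F => cub p.1) (wOp X F (fun x => w x ^ 2) * G) Y Y' ≤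
      C * Real.exp (-(ρ * tdist1 Kv Y Y')))
    (hGw1 : ∀ μ Y Y', blockNorm (fun p : X × F => cub p.1) (fun p : X × F => cub p.1) (wOp X F w * (Dfw X F sh η μ * G)) Y Y' ≤
      C * Real.exp (-(ρ * tdist1 Kv Y Y')))
    (c₀ : B13.Consts) (Xs : Finset (UT Kv)) (R : ℝ) (Ub Ubi : ι → E → X → Matrix F F ℂ)
    (Aav : E → Matrix (X × F) (X × F) ℂ) (α₀ α₁ αav ε μ cμ : ℝ)
    (hUbh : ∀ ν x a b, DifferentiableOn ℂ (fun u => Ub ν u x a b) (ball (0 : E) R))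
    (hUbih : ∀ ν x a b, DifferentiableOn ℂ (fun u => Ubi ν u x a b) (ball (0 : E) R))
    (hAavh : ∀ p q, DifferentiableOn ℂ (fun u => Aav u p q) (ball (0 : E) R))
    (hinv : ∀ ν u x, Ub ν u x * Ubi ν u x = 1) (hα₀ : 0 ≤ α₀) (hα₁ : 0 ≤ α₁) (hαav : 0 ≤ αav)
    (hb0 : ∀ ν, ∀ u ∈ ball (0 : E) R, ∀ x a, ∑ b, ‖(Ub ν u x - 1) a b‖ ≤ η * α₀ * w x)
    (hb1 : ∀ ν, ∀ u ∈ ball (0 : E) R, ∀ x a, ∑ b, ‖(Ub ν u ((sh ν).symm x) - 1) a b‖ ≤ η * α₀ * w x)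
    (hb2 : ∀ ν, ∀ u ∈ ball (0 : E) R, ∀ x a, ∑ b, ‖(Ubi ν u ((sh ν).symm x) - 1) a b‖ ≤ η * α₀ * w x)
    (hder : ∀ ν, ∀ u ∈ ball (0 : E) R, ∀ x a, ∑ b, ‖(Ub ν u x - Ub ν u ((sh ν).symm x)) a b‖ ≤ η ^ 2 * α₁ * w x ^ 2)
    (hloc : ∀ u p q, Aav u p q ≠ 0 → cub p.1 = cub q.1) (hav : ∀ u ∈ ball (0 : E) R, ∀ p, ∑ q, ‖Aav u p q‖ ≤ αav)
    (hμ : 0 ≤ μ) (hμε : 2 * μ ≤ ε) (hμκ : 2 * μ ≤ ρ - ε - μ) (hcμ : 0 ≤ cμ)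
    (hrow : RowSum (toB6 (torusGeom Kv 0 0 0) 0 True) μ cμ)
    (hq : cμ * (cμ * 1 * (1 * ((0 + ∑ j : Unit ⊕ (ι ⊕ ι),
      covAlphaW α₀ ((Fintype.card ι : ℝ) * (α₁ + α₀ ^ 2) + αav) j * covBW ρ Λ j) * C)) * cμ) * cμ < 1) :
    ∃ (W : Type) (T : W → (TPt dd N' → ℂ) → E → Matrix (X × F) (X × F) ℂ) (SX' : Set W) (A' : W → ℝ)
      (D' : W → UT Kv → UT Kv → ℝ),
      BlockWalkExpansion c₀ (fun p : X × F => cub p.1) (fun p : X × F => cub p.1)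
        (fun (_ : TPt dd N' → ℂ) u => G * (1 - (covShift X F sh η (fun ν u x => Ub ν u x - 1)
            (fun ν u x => Ubi ν u ((sh ν).symm x) - 1) u + Aav u * wOp X F (fun x => w x ^ 2)) * G)⁻¹) Xs R
        (ε - 2 * μ) (ρ - ε - μ - 2 * μ)
        (cμ * C * (1 * (1 - cμ * (cμ * 1 * (1 * ((0 + ∑ j : Unit ⊕ (ι ⊕ ι),
          covAlphaW α₀ ((Fintype.card ι : ℝ) * (α₁ + α₀ ^ 2) + αav) j * covBW ρ Λ j) * C)) * cμ) * cμ)⁻¹) * cμ)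
        T SX' A' D' (ρ - 2 * μ) ∧
      (∀ (j : Unit ⊕ (ι ⊕ ι)) ω (σ : TPt dd N' → ℂ), (∀ i, ‖σ i‖ ≤ Real.exp c₀.κ₁) → ∀ u ∈ ball (0 : E) R, ∀ Y Y',
        blockNorm (fun p : X × F => cub p.1) (fun p : X × F => cub p.1) (covDopW X F sh η w j * T ω σ u) Y Y' ≤
          covBW (ι := ι) ρ Λ j * (A' ω * Real.exp (-((ρ - 2 * μ) * D' ω Y Y')))) ∧
      ∀ ω, DomBy (toB6 (torusGeom Kv 0 0 0) 0 True) (D' ω) := by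
  refine blockWalkExpansion_covShiftWAv_of_letters cub hη hw hΛ hsh hwr G hC hρ hG hGw2 hGw1 c₀ Xs R
    (fun ν u x => Ub ν u x - 1) (fun ν u x => Ubi ν u ((sh ν).symm x) - 1) Aav α₀ ((Fintype.card ι : ℝ) * (α₁ + α₀ ^ 2)) αav ε μ cμ
    (fun ν x a b => bondDefect_holo (hUbh ν x) a b) (fun ν x a b => bondDefect_holo (hUbih ν _) a b) hAavh hα₀ (by positivity) hαav
    hb0 hb2 (fun u hu x a => ?_) hloc hav hμ hμε hμκ hcμ hrow hq
  have hδ : 0 ≤ η * α₀ * w x := by have := hw x; positivity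
  calc ∑ b, ‖(∑ ν, ((Ub ν u x - 1) + (Ubi ν u ((sh ν).symm x) - 1))) a b‖
      ≤ ∑ ν, ∑ b, ‖((Ub ν u x - 1) + (Ubi ν u ((sh ν).symm x) - 1)) a b‖ := rowMass_sum_le' _ _ _
    _ ≤ ∑ _ν : ι, (η ^ 2 * α₁ * w x ^ 2 + (η * α₀ * w x) * (η * α₀ * w x)) := Finset.sum_le_sum fun ν _ =>
        rowSum_fwd_bwd_defect_le _ _ _ (hinv ν u _) hδ (hder ν u hu x) (hb1 ν u hu x) (hb2 ν u hu x) a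
    _ = η ^ 2 * ((Fintype.card ι : ℝ) * (α₁ + α₀ ^ 2)) * w x ^ 2 := by
        rw [Finset.sum_const, Finset.card_univ, nsmul_eq_mul]; ring

end Step

end Summit.QuantumFields.BalabanUV.Gaps.D4WalkBlockBondFieldWeighted

end
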